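import Mathlib
import Summits.HodgeConjecture.HodgeConjecture.Theorems.Ring2AtlasCMThreefoldsCyclotomic21
import Summits.HodgeConjecture.FermatCycles.HodgeFermatHypUWalk3

/-!
# LEMMA S at every odd squarefree level (`HodgeFermat/HypUOdd.lean`; HF-G25)

Tree copy (whole module) of the module `HodgeFermat/HypUOdd.lean` of the sibling cell's standalone package
`run/shared/lean/pub/pub-hodgefermat/lean/HodgeFermat/` (133 lines, sha256 `e4bf3ce5c34c01d0…`), source lines 29–133 (all: `Good`-ranges glued, `hypU_of_range`, `good3_of_range3`, `GoodOdd`, `goodOdd_of_ranges`; the two exceptions `not_good_21`, `not_good_39`).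
Filed by cell `pub-hfermat`, seat prover-1 gen-3, on the COORDINATOR KEEPER RULING of 2026-08-25 (gem sweep H1: take the
off-gate kernel theorem `thmFstar` through the gate) — here THEOREM F* of `tables/DPRIME-THEOREM.md` §9 IN FULL, i.e.
PROPOSITION D′(3N) and the descent (`HodgeFermat/PropDPrimeNFinal.lean`, GATE HF-G34), the last off-gate form of THEOREM F*
(its first two forms, `DecodingFinal.thmFstar` = F* at the prime levels and `ThmFstarNFinal.thmFstar` = F*(3N), landed on
2026-08-25 as `HodgeFermatThmFstar.lean` / `HodgeFermatThmFstarN.lean`, seats prover-1 gen-0 / gen-2); this file is one link of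
the import closure of `PropDPrimeNFinal.propDprime` (the sibling's KR-free chain: THEOREM L, COROLLARY M, THEOREM D6,
THEOREM U⁺, THEOREM KR6, THEOREM Z3U) on top of those landed chains.  The source module is the sibling's hub-checked module of
record (pub-hodgefermat `CERT.md` l.906, GATE HF-G25; cell record `check/HypUOdd_standalone.lean` sha256 `6714d248d52c5cb3…`); its declarations are copied VERBATIM.
Deviations from the source module, exhaustively: the `import` lines (tree modules `Summits.HodgeConjecture.FermatCycles.
HodgeFermat*` instead of `HodgeFermat.*`); this module docstring; DEDUP (pre-empting the gate's `dedup.landed`): the source's `theorem totient_21 : Nat.totient 21 = 12` (l.113–115) restates the landed `Summit.HodgeConjecture.HodgeConjecture.Ring2.Atlas.Cyclotomic21.totient_21` (`Summits/HodgeConjecture/HodgeConjecture/Theorems/Ring2AtlasCMThreefoldsCyclotomic21.lean`) VERBATIM and is DELETED, re-bound under the same name by the added line `export Summit.HodgeConjecture.HodgeConjecture.Ring2.Atlas.Cyclotomic21 (totient_21)` (extra import; `export` keeps `HypUOdd.totient_21` available downstream); one-line docstrings added (gate lint) to `tau_21_3`, `tau_21_7`, `tau_39_3`, `tau_39_13`,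 `primeFactors_21`, `primeFactors_39`, `totient_39`.
Every other line — in particular every declaration's statement and proof — is byte-identical to the source.
HONEST FRAMING: explicit algebraic cycles for specific Hodge classes on Fermat/Delsarte varieties; residual open instances
listed; no claim on general Hodge.  (This file is arithmetic of CM types / finite combinatorics / analytic number theory
of the sibling's KR-free programme; it claims nothing about cycles.)

The source module's docstring (HypUOdd.lean l.6–27), verbatim:

## LEMMA S at every odd squarefree level (HF-G25)

`GoodOdd` — for every squarefree ODD `N > 1` other than `21` and `39`,
`6 * ∑ p ∈ N.primeFactors, tau N p < φ(N)`, i.e. `U(N) < 1/6` (LEMMA S of `tables/SEMI-THEOREM.md` §2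
in its full scope: the prime `3` may divide `N`).  Generation 24 proved this for `N` prime to `6`
(`HypU`); the levels divisible by `3` are new: a kernel walk below `10⁵` (`HypUWalk3`/`HypURange3`,
tail levels skipped with a checked certificate) and the tail `HypUTailOdd.goodTail` beyond.

THIS module is the LIGHT half (no chunk theorems): `goodOdd_of_ranges : URange 2 30001 → URange3 3 100001 →
GoodOdd` (and `hypU_of_range`, `good3_of_range3`), so that the whole argument can be hub-checked in one quick
file as a function of the two certified range statements (`check/HypUOdd_standalone.lean`,
`check/ThmUOddLight_standalone.lean`), exactly as generation 23's `theoremD6_of_ranges`; the ranges are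
supplied in `HypUOddFinal.lean` (`goodOdd : GoodOdd`, from `HypURange30k.uRange_2_30001` and
`HypURange3.uRange3_3_100001`), and everything together is `check/UOdd_standalone.lean`.
The two exceptions are genuine: `not_good_21` (`6·(0+2) = 12 = φ(21)`) and `not_good_39`
(`6·(4+2) = 36 > 24 = φ(39)`).

No analytic input: this module and its imports are elementary (orders in `(ℤ/m)ˣ`, `Nat.log`, the harmonic
bound).  The consequences for Dirichlet characters, LEMMA W and THEOREM U at the levels divisible by `3`
are drawn in `TheoremUOdd.lean` / `TheoremUOddFinal.lean`.
-/

set_option autoImplicit false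

namespace HodgeFermat.KRFree.HypUOdd

open Finset HodgeFermat.KRFree.HypBReduction HodgeFermat.KRFree.HypUCert

export Summit.HodgeConjecture.HodgeConjecture.Ring2.Atlas.Cyclotomic21 (totient_21)

/-- LEMMA S at the odd squarefree levels: `U(N) < 1/6` for every squarefree odd `N > 1`, `N ∉ {21, 39}`. -/
def GoodOdd : Prop :=
  ∀ N, 1 < N → Squarefree N → ¬ 2 ∣ N → N ≠ 21 → N ≠ 39 → 6 * ∑ p ∈ N.primeFactors, tau N p < N.totient

/-- HYPOTHESIS U (levels prime to `6`) from the certified range to `3·10⁴` (generation 24's assembly,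
without the analytic chain): the tail is `HypUTailQ.uTail : UTail 30000`. -/
theorem hypU_of_range (h1 : URange 2 30001) : HypU := hypU_of_range_tail 30000 h1 HypUTailQ.uTail

/-- the levels divisible by `3`, given the walk below `100001`: tail beyond by `goodTail_100000`. -/
theorem good3_of_range3 (h3r : URange3 3 100001) (N : ℕ) (hsq : Squarefree N) (h2 : ¬ 2 ∣ N)
    (h3 : 3 ∣ N) (h21 : N ≠ 21) (h39 : N ≠ 39) : Good N := by
  have hN0 : N ≠ 0 := fun h => by subst h; exact not_squarefree_zero hsq
  by_cases hN : N < 100001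
  · exact h3r N (Nat.le_of_dvd (by omega) h3) hN hsq h2 h3 h21 h39
  · exact goodTail_100000 N hsq h2 (by omega)

/-- **LEMMA S** at every odd squarefree level `N > 1` other than `21, 39`, as a function of the two
certified range statements (`HypURange30k.uRange_2_30001`, `HypURange3.uRange3_3_100001`;
composed in `HypUOddFinal.goodOdd`). -/
theorem goodOdd_of_ranges (h1 : URange 2 30001) (h3r : URange3 3 100001) : GoodOdd :=
  fun N hN1 hsq h2 h21 h39 =>
    if h3 : 3 ∣ N then good3_of_range3 h3r N hsq h2 h3 h21 h39 else hypU_of_range h1 N hN1 hsq h2 h3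

/-! ## The two exceptions are genuine -/

/-- `tau 21 3 = 0` (3 has `−1` as a power mod 7) -/
theorem tau_21_3 : tau 21 3 = 0 := by
  unfold tau
  rw [if_pos]
  rw [show (21 / 3 : ℕ) = 7 by norm_num]
  exact ⟨3, by decide⟩

/-- `tau 21 7 = 2` -/
theorem tau_21_7 : tau 21 7 = 2 := by
  unfold tau
  rw [show (21 / 7 : ℕ) = 3 by norm_num]
  have h7 : ((7 : ℕ) : ZMod 3) = 1 := by decide
  rw [if_neg, h7, orderOf_one]
  · decide
  · rintro ⟨k, hk⟩
    rw [h7, one_pow] at hk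
    exact absurd hk (by decide)

/-- `tau 39 3 = 4` -/
theorem tau_39_3 : tau 39 3 = 4 := by
  unfold tau
  rw [show (39 / 3 : ℕ) = 13 by norm_num]
  have hord : orderOf ((3 : ℕ) : ZMod 13) = 3 := by
    apply orderOf_eq_prime
    · decide
    · decide
  rw [if_neg, hord]
  · decide
  · rintro ⟨k, hk⟩
    have h3 : ((3 : ℕ) : ZMod 13) ^ (k % 3) = -1 := by
      have e := pow_mod_orderOf ((3 : ℕ) : ZMod 13) k
      rw [hord] at e
      rw [e]; exact hk
    have hlt : k % 3 < 3 := Nat.mod_lt _ (by norm_num)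
    interval_cases (k % 3) <;> exact absurd h3 (by decide)

/-- `tau 39 13 = 2` -/
theorem tau_39_13 : tau 39 13 = 2 := by
  unfold tau
  rw [show (39 / 13 : ℕ) = 3 by norm_num]
  have h13 : ((13 : ℕ) : ZMod 3) = 1 := by decide
  rw [if_neg, h13, orderOf_one]
  · decide
  · rintro ⟨k, hk⟩
    rw [h13, one_pow] at hk
    exact absurd hk (by decide)

/-- the prime factors of 21 -/
theorem primeFactors_21 : (21 : ℕ).primeFactors = {3, 7} := by
  rw [show (21 : ℕ) = 3 * 7 by norm_num, Nat.primeFactors_mul (by norm_num) (by norm_num),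
    Nat.prime_three.primeFactors, (by norm_num : Nat.Prime 7).primeFactors]
  rfl

/-- the prime factors of 39 -/
theorem primeFactors_39 : (39 : ℕ).primeFactors = {3, 13} := by
  rw [show (39 : ℕ) = 3 * 13 by norm_num, Nat.primeFactors_mul (by norm_num) (by norm_num),
    Nat.prime_three.primeFactors, (by norm_num : Nat.Prime 13).primeFactors]
  rfl

/-- `φ(39) = 24` -/
theorem totient_39 : Nat.totient 39 = 24 := by
  rw [show (39 : ℕ) = 3 * 13 by norm_num, Nat.totient_mul (by norm_num),
    Nat.totient_prime Nat.prime_three, Nat.totient_prime (by norm_num : Nat.Prime 13)]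

/-- `N = 21` is a genuine exception of LEMMA S: `6 · (τ(21,3) + τ(21,7)) = 6 · (0 + 2) = 12 = φ(21)`. -/
theorem not_good_21 : ¬ Good 21 := by
  unfold Good
  rw [primeFactors_21, Finset.sum_pair (by norm_num), tau_21_3, tau_21_7, totient_21]
  norm_num

/-- `N = 39` is a genuine exception of LEMMA S: `6 · (τ(39,3) + τ(39,13)) = 6 · (4 + 2) = 36 > 24 = φ(39)`. -/
theorem not_good_39 : ¬ Good 39 := by
  unfold Good
  rw [primeFactors_39, Finset.sum_pair (by norm_num), tau_39_3, tau_39_13, totient_39]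
  norm_num

end HodgeFermat.KRFree.HypUOdd
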